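import Summits.ResolutionOfSingularities.ResolutionOfSingularities.Theorems.HilbertSamuelEliminationSigmaMaxModificationsCorridor3WLadderIsoKernelKrullAkizukiFractions
import HarnessLib

/-!
# [OURS · L1 W4.2] THE CURVE-SHADOW THEOREM, RING LEVEL: along a chain of local rings READ ON A CURVE, satellite steps and residue jumps
# are finite in number (Krull–Akizuki) — the tail is free-rational

Crux chain w42 (`SigmaMaxModifications`, stmt-ResolutionOfSingularities-18506; conjunct `SigmaMaxModificationsCorridor3`, stmt-…-19249),
line `w_ladder`, registered stub `stub_isoSepRecurrent` (K2-sep ∧ K3-sep) of skeleton v8.8 — kernel census «NO ISOLATED E3 POINT TOWER FOLLOWS A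
CURVE» (lead res-L1-w42-lead-1, gen 6), file 2/3: the chain-level theorem; file 1/3 = `…IsoKernelKrullAkizukiFractions` (the two Krull–Akizuki
bricks), file 3/3 = the scheme-level transport onto `IsIsoPointTower` and the assembly with K1. Helper file
`--supports stmt-ResolutionOfSingularities-19249`; kernel only (no definition, no named fact).

THE SETTING (all hypotheses explicit, no structure). `B 0 ≤ B 1 ≤ ⋯` local subrings of a field `L`, each DOMINATING the previous one
(`SubringDominates`, Cutkosky §2.1) — the images of the stalks `𝒪_{X_n,x_n}` of a point tower in `K(X_0)`; READ ON A CURVE: ring maps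
`φ n : B n → F` into a field, compatible with the inclusions, all dominated by ONE valuation ring `W` of `F` (`φ n (B n) ⊆ W`, `φ n (𝔪) ⊆ 𝔪_W`) —
in the application `F = κ(c₀)`, the residue field of the generic point `c₀` of a curve `C ∋ x₀` whose strict transforms pass through every `x_n`,
`φ n` = (stalk at `x_n`) → (stalk at `c_n`) → `κ(c_n) = κ(c₀)`, and `W` = any valuation ring of `κ(c₀)` dominating the increasing union of the
images (local rings `𝒪_{C_n,x_n}` of the curve); `φ 0 ≢ 0` on `𝔪(B 0)` (`c₀ ≠ x₀`), every reading a fraction of readings of `B 0` (birationality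
of the `C_n`), and `B 0 ⧸ ker φ₀` (`= 𝒪_{C,x₀}`) of Krull dimension `≤ 1` (C IS A CURVE).

WHAT IS PROVED. (§2) chain bookkeeping (`subringDominates_of_le`, `le_of_le`, `inclusion_mem_maximalIdeal`, `reading_inclusion`,
`mem_maximalIdeal_iff_valuation_lt_one`: under domination by `W` the maximal ideal of `B n` is read off the values).
(§3 i) `eventually_not_satellite_of_shadow`: if moreover each `𝔪(B n)·B(n+1)` is generated by one `t n ∈ 𝔪(B n)` (quadratic-transform shape),
then from some `n₀` on every step is NON-SATELLITE — `𝔪(B(n+1)) ⊆ t·B(n+2)` for some `t ∈ 𝔪(B n)`, i.e. `𝔪(B n)B(n+2) = 𝔪(B(n+1))B(n+2)`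
(Zariski's «free» infinitely near points): `t n = s n · t(n+1)` in `B(n+2)`, the `W`-values of `φ(t n)` are monotone and move STRICTLY exactly at
the satellite steps (`s n` a non-unit), and Krull–Akizuki (file 1, §1 a) forbids infinitely many strict moves below `v(φ t₀)`.
(§3 ii) `eventually_residue_surjective_of_shadow`: from some `n₀` on there are NO RESIDUE JUMPS — every `y ∈ B(n+1)` is congruent mod
`𝔪(B(n+1))` to an element of `B n`: the residue fields embed compatibly in `κ(W)` as an increasing chain of `κ(B 0)`-subspaces, each of dimension
`≤ ℓ(S/dS)` by the residue bound (file 1, §1 b), hence eventually stationary. Auxiliary: `exists_strictMono_of_frequently`,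
`eventually_const_of_monotone_le`.
(§4, the SUBRING FORM with the valuation ring supplied by Chevalley, is the companion `…IsoKernelCurveShadowOverring`.)

HONEST FRAMING. OURS plumbing over textbook commutative algebra (Krull–Akizuki: Matsumura Thm. 11.7; Abhyankar 1956 Thm. 1; proximity /
satellite points: Zariski–Samuel II App. 5, Casas-Alvero ch. 3); nothing here is a statement of H. Hironaka's manuscript [Hironaka2017] nor of
[CossartJannsenSaito2020] / [CossartPiltant2009]. AI-written; AI review is weaker than expert review.
References: H. Matsumura, *Commutative ring theory*, Thm. 11.7 [Matsumura1987]; S. S. Abhyankar, Amer. J. Math. 78 (1956), Thm. 1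
[Abhyankar1956Valuations]; S. D. Cutkosky, *Introduction to Algebraic Geometry* / resolution notes §2.1 (domination) [Cutkosky2014].
-/

noncomputable section

set_option linter.dupNamespace false

open IsLocalRing
open Literature.AlgebraicGeometry.Resolution

namespace Summit.ResolutionOfSingularities.ResolutionOfSingularities.Cruxes.SigmaMaxModifications.IdeasL1C5

universe u

/-! ## §2. Chains of local subrings of a field: iterated domination and compatible readings -/

section ChainBasics

variable {L : Type u} [Field L]

/-- A dominated local subring's maximal ideal goes INTO the maximal ideal of the dominating ring. [cite: Cutkosky2014, §2.1] -/
theorem inclusion_mem_maximalIdeal {R R' : Subring L} [IsLocalRing R] [IsLocalRing R'] (h : SubringDominates R R')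
    {x : R} (hx : x ∈ maximalIdeal R) : Subring.inclusion h.1 x ∈ maximalIdeal R' := by
  rw [mem_maximalIdeal_iff_inv_not_mem] at hx ⊢
  rcases hx with hx | hx
  · exact Or.inl hx
  · refine Or.inr fun hxS => hx (h.2 _ x.2 hxS)

/-- … and conversely an element of `R` lying in the maximal ideal of the dominating ring is in the maximal ideal of `R`. [cite: Cutkosky2014, §2.1] -/
theorem mem_maximalIdeal_of_inclusion_mem {R R' : Subring L} [IsLocalRing R] [IsLocalRing R'] (h : SubringDominates R R')
    {x : R} (hx : Subring.inclusion h.1 x ∈ maximalIdeal R') : x ∈ maximalIdeal R := by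
  rw [mem_maximalIdeal_iff_inv_not_mem] at hx ⊢
  rcases hx with hx | hx
  · exact Or.inl hx
  · exact Or.inr fun hxR => hx (h.1 hxR)

variable {B : ℕ → Subring L} (hdom : ∀ n, SubringDominates (B n) (B (n + 1)))
include hdom

/-- Along a chain in which each ring dominates the previous one, `B m` is dominated by `B n` for `m ≤ n`. [folklore] -/
theorem subringDominates_of_le {m n : ℕ} (h : m ≤ n) : SubringDominates (B m) (B n) := by
  induction h with
  | refl => exact SubringDominates.refl _
  | step _ ih => exact ih.trans (hdom _)

/-- … in particular `B m ≤ B n`. [folklore] -/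
theorem le_of_le {m n : ℕ} (h : m ≤ n) : B m ≤ B n := (subringDominates_of_le hdom h).1

end ChainBasics

/-! ## §3. THE SHADOWED CHAIN: finitely many satellite steps, finitely many residue jumps -/

section Shadow

variable {L : Type u} [Field L] {F : Type u} [Field F]
  {B : ℕ → Subring L}
  (hdom : ∀ n, SubringDominates (B n) (B (n + 1)))
  (φ : ∀ n, B n →+* F) (hφ : ∀ n (x : B n), φ (n + 1) (Subring.inclusion (hdom n).1 x) = φ n x)

include hφ in
/-- Compatibility of the readings along `m ≤ n`. [folklore] -/
theorem reading_inclusion {m n : ℕ} (h : m ≤ n) (x : B m) : φ n (Subring.inclusion (le_of_le hdom h) x) = φ m x := by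
  induction h with
  | refl => rfl
  | step h ih => exact (congrArg (φ _) (Subtype.ext rfl)).trans ((hφ _ _).trans ih)

variable [hloc : ∀ n, IsLocalRing (B n)] (W : ValuationSubring F) (hW : ∀ n (x : B n), φ n x ∈ W)
  (hWdom : ∀ n (x : B n), x ∈ maximalIdeal (B n) → W.valuation (φ n x) < 1)

include hW hWdom in
/-- Under domination by `W`, an element of `B n` is in the maximal ideal iff its reading has value `< 1` (units read as units of `W`). [folklore] -/
theorem mem_maximalIdeal_iff_valuation_lt_one (n : ℕ) (x : B n) : x ∈ maximalIdeal (B n) ↔ W.valuation (φ n x) < 1 := by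
  refine ⟨hWdom n x, fun hlt => ?_⟩
  by_contra hx
  obtain ⟨u, rfl⟩ := (IsLocalRing.notMem_maximalIdeal.mp hx)
  have h1 : W.valuation (φ n (u : B n)) * W.valuation (φ n (↑u⁻¹ : B n)) = 1 := by
    rw [← map_mul, ← map_mul, Units.mul_inv, map_one, map_one]
  have hle : W.valuation (φ n (↑u⁻¹ : B n)) ≤ 1 := (W.valuation_le_one_iff _).mpr (hW n _)
  have : W.valuation (φ n (u : B n)) * W.valuation (φ n (↑u⁻¹ : B n)) < 1 * 1 :=
    mul_lt_mul_of_lt_of_le_of_nonneg_of_pos hlt hle zero_le zero_lt_one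
  rw [h1, one_mul] at this
  exact lt_irrefl _ this


/-- From «for every `n₀` there is a later `n` with `P n`» extract a strictly increasing sequence of witnesses. [folklore] -/
theorem exists_strictMono_of_frequently {P : ℕ → Prop} (h : ∀ n₀, ∃ n, n₀ ≤ n ∧ P n) :
    ∃ e : ℕ → ℕ, StrictMono e ∧ ∀ i, P (e i) := by
  choose nx hnx hP using h
  let e : ℕ → ℕ := fun i => Nat.rec (nx 0) (fun _ k => nx (k + 1)) i
  have he0 : e 0 = nx 0 := rfl
  have hes : ∀ i, e (i + 1) = nx (e i + 1) := fun i => rfl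
  refine ⟨e, strictMono_nat_of_lt_succ fun i => ?_, fun i => ?_⟩
  · rw [hes]; exact Nat.lt_of_lt_of_le (Nat.lt_succ_self _) (hnx _)
  · cases i with
    | zero => rw [he0]; exact hP 0
    | succ i => rw [hes]; exact hP _

include hφ hW hWdom in
/-- **(i) FINITELY MANY SATELLITE STEPS ALONG A CURVE SHADOW.** Chain `B 0 ≤ B 1 ≤ ⋯` of local subrings of `L`, each dominating the previous
one, with `𝔪(B n)·B(n+1)` generated by one element `t n ∈ 𝔪(B n)` (quadratic-transform shape); compatible readings `φ n : B n → F` dominated by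
the valuation ring `W`, `φ 0 ≢ 0` on `𝔪(B 0)`, every reading a fraction of readings of `B 0`, and `B 0 ⧸ ker φ₀` of Krull dimension `≤ 1` (the
shadow is a CURVE). Then from some `n₀` on every step is NON-SATELLITE in the element form «`𝔪(B(n+1)) ⊆ t·B(n+2)` for some `t ∈ 𝔪(B n)`»
(so `𝔪(B n)·B(n+2) = 𝔪(B(n+1))·B(n+2)`). Mechanism: `t n = s n · t(n+1)` in `B(n+2)`; the `W`-values of the readings `φ(t n)` form a monotone
sequence, STRICTLY monotone exactly at the steps where `s n` is a non-unit, i.e. at the satellite steps; Krull–Akizuki (§1 a) forbids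
infinitely many strict steps. [cite: Matsumura1987, Thm. 11.7] [cite: Abhyankar1956Valuations, Thm. 1] -/
theorem eventually_not_satellite_of_shadow [IsNoetherianRing (B 0)]
    (hprin : ∀ n, ∃ t ∈ maximalIdeal (B n), ∀ x ∈ maximalIdeal (B n), ∃ y : B (n + 1), (x : L) = y * t)
    (h0 : ∃ x ∈ maximalIdeal (B 0), φ 0 x ≠ 0)
    (hfrac : ∀ n (x : B n), ∃ a b : B 0, φ 0 b ≠ 0 ∧ φ n x * φ 0 b = φ 0 a)
    (hdim : Ring.KrullDimLE 1 (B 0 ⧸ RingHom.ker (φ 0))) :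
    ∃ n₀, ∀ n, n₀ ≤ n → ∃ t ∈ maximalIdeal (B n), ∀ x ∈ maximalIdeal (B (n + 1)), ∃ y : B (n + 2), (x : L) = y * t := by
  classical
  choose t ht hgen using hprin
  -- `t n ∈ 𝔪(B(n+1))`, so `t n = s n * t (n+1)` with `s n ∈ B (n+2)`
  have htincl : ∀ n, Subring.inclusion (hdom n).1 (t n) ∈ maximalIdeal (B (n + 1)) :=
    fun n => inclusion_mem_maximalIdeal (hdom n) (ht n)
  have hs' : ∀ n, ∃ s : B (n + 2), (t n : L) = s * t (n + 1) := fun n => hgen (n + 1) _ (htincl n)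
  choose s hs using hs'
  -- readings of the `t n` and their values
  have hle2 : ∀ n, B n ≤ B (n + 2) := fun n => le_of_le hdom (Nat.le_add_right n 2)
  have hincl2 : ∀ n, Subring.inclusion (hle2 n) (t n) = s n * Subring.inclusion (hdom (n + 1)).1 (t (n + 1)) :=
    fun n => Subtype.ext (hs n)
  have hread : ∀ n, φ n (t n) = φ (n + 2) (s n) * φ (n + 1) (t (n + 1)) := by
    intro n
    rw [← reading_inclusion hdom φ hφ (Nat.le_add_right n 2) (t n), hincl2, map_mul, hφ]
  let a : ℕ → _ := fun n => W.valuation (φ n (t n))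
  have ha : ∀ n, a n = W.valuation (φ (n + 2) (s n)) * a (n + 1) := fun n => by
    simp only [a]; rw [hread, map_mul]
  have hmono1 : ∀ n, a n ≤ a (n + 1) := fun n => by
    rw [ha]
    exact mul_le_of_le_one_left zero_le ((W.valuation_le_one_iff _).mpr (hW _ _))
  have hmono : Monotone a := monotone_nat_of_le_succ hmono1
  -- the readings `φ n (t n)` are nonzero
  obtain ⟨x₀, hx₀, hx₀0⟩ := h0
  have hane : ∀ n, φ n (t n) ≠ 0 := by
    intro n hzero
    have hkill : ∀ x ∈ maximalIdeal (B n), φ n x = 0 := by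
      intro x hx
      obtain ⟨y, hy⟩ := hgen n x hx
      have hxy : Subring.inclusion (hdom n).1 x = y * Subring.inclusion (hdom n).1 (t n) := Subtype.ext hy
      rw [← hφ n x, hxy, map_mul, hφ, hzero, mul_zero]
    refine hx₀0 ?_
    rw [← reading_inclusion hdom φ hφ (Nat.zero_le n) x₀]
    exact hkill _ (inclusion_mem_maximalIdeal (subringDominates_of_le hdom (Nat.zero_le n)) hx₀)
  -- a non-strict step is a non-satellite step
  have hstep : ∀ n, a n = a (n + 1) → ∃ t' ∈ maximalIdeal (B n), ∀ x ∈ maximalIdeal (B (n + 1)),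
      ∃ y : B (n + 2), (x : L) = y * t' := by
    intro n hn
    have hs1 : W.valuation (φ (n + 2) (s n)) = 1 := by
      have h := ha n
      rw [hn] at h
      have hne : a (n + 1) ≠ 0 := (map_ne_zero _).mpr (hane (n + 1))
      exact (mul_eq_right₀ hne).mp h.symm
    have hsunit : IsUnit (s n) := by
      by_contra hsu
      have hlt := hWdom _ _ ((IsLocalRing.mem_maximalIdeal _).mpr hsu)
      rw [hs1] at hlt
      exact lt_irrefl _ hlt
    obtain ⟨u, hu⟩ := hsunit
    refine ⟨t n, ht n, fun x hx => ?_⟩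
    obtain ⟨y, hy⟩ := hgen (n + 1) x hx
    refine ⟨y * ↑u⁻¹, ?_⟩
    have hut : (t (n + 1) : L) = ((↑u⁻¹ : B (n + 2)) : L) * t n := by
      rw [hs n, ← hu, ← mul_assoc, ← Subring.coe_mul, Units.inv_mul, Subring.coe_one, one_mul]
    rw [hy, hut, ← mul_assoc, Subring.coe_mul]
  -- Krull–Akizuki: only finitely many strict steps
  by_contra hcon
  push Not at hcon
  have hfreq : ∀ n₀, ∃ n, n₀ ≤ n ∧ a n < a (n + 1) := by
    intro n₀
    obtain ⟨n, hn, hbad⟩ := hcon n₀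
    refine ⟨n, hn, lt_of_le_of_ne (hmono1 n) fun heq => ?_⟩
    obtain ⟨t', ht', hgood⟩ := hstep n heq
    obtain ⟨x, hx, hxbad⟩ := hbad t' ht'
    obtain ⟨y, hy⟩ := hgood x hx
    exact hxbad y hy
  obtain ⟨e, hemono, he⟩ := exists_strictMono_of_frequently hfreq
  -- the one-dimensional domain `S = B 0 ⧸ ker φ₀ ↪ F`
  let S := B 0 ⧸ RingHom.ker (φ 0)
  let jS : S →+* F := RingHom.kerLift (φ 0)
  have hjS : Function.Injective jS := RingHom.kerLift_injective (φ 0)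
  haveI : (RingHom.ker (φ 0)).IsPrime := RingHom.ker_isPrime (φ 0)
  haveI : IsDomain S := Ideal.Quotient.isDomain _
  haveI : IsNoetherianRing S := inferInstance
  haveI := hdim
  have hSW : ∀ z : S, jS z ∈ W := by
    intro z
    obtain ⟨b, rfl⟩ := Ideal.Quotient.mk_surjective z
    rw [RingHom.kerLift_mk]; exact hW 0 b
  have hd : Ideal.Quotient.mk (RingHom.ker (φ 0)) (t 0) ≠ 0 := by
    rw [Ne, Ideal.Quotient.eq_zero_iff_mem, RingHom.mem_ker]; exact hane 0
  refine false_of_strictMono_valuation_of_fractions jS hjS W hSW hd (fun i => φ (e i) (t (e i))) (fun i => hW _ _)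
    (fun i => ?_) ?_ (fun i => ?_)
  · obtain ⟨a', b', hb', hab'⟩ := hfrac (e i) (t (e i))
    exact ⟨Ideal.Quotient.mk _ a', Ideal.Quotient.mk _ b', by rwa [RingHom.kerLift_mk], by rwa [RingHom.kerLift_mk, RingHom.kerLift_mk]⟩
  · rw [RingHom.kerLift_mk]
    exact hmono (Nat.zero_le (e 0))
  · exact lt_of_lt_of_le (he i) (hmono (hemono (Nat.lt_succ_self i)))


/-- A monotone sequence of natural numbers bounded above is eventually constant. [folklore] -/
theorem eventually_const_of_monotone_le {f : ℕ → ℕ} (hf : Monotone f) {ℓ : ℕ} (hℓ : ∀ n, f n ≤ ℓ) :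
    ∃ n₀, ∀ n, n₀ ≤ n → f n = f (n + 1) := by
  by_contra hcon
  push Not at hcon
  have hfreq : ∀ n₀, ∃ n, n₀ ≤ n ∧ f n < f (n + 1) := fun n₀ => by
    obtain ⟨n, hn, hne⟩ := hcon n₀
    exact ⟨n, hn, lt_of_le_of_ne (hf (Nat.le_succ n)) hne⟩
  obtain ⟨e, hemono, he⟩ := exists_strictMono_of_frequently hfreq
  have hgrow : ∀ i, i ≤ f (e i) := by
    intro i
    induction i with
    | zero => exact Nat.zero_le _
    | succ i ih =>
      exact Nat.succ_le_of_lt (lt_of_le_of_lt ih (lt_of_lt_of_le (he i) (hf (hemono (Nat.lt_succ_self i)))))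
  exact absurd (hℓ (e (ℓ + 1))) (not_le.mpr (Nat.lt_of_lt_of_le (Nat.lt_succ_self ℓ) (hgrow (ℓ + 1))))

include hφ hW hWdom in
/-- **(ii) FINITELY MANY RESIDUE JUMPS ALONG A CURVE SHADOW.** Same chain and readings as in (i) (the principal generators are not needed):
from some `n₀` on, the residue field does not grow — every `y ∈ B(n+1)` is congruent modulo `𝔪(B(n+1))` to an element of `B n`. Mechanism:
the residue fields `κ(B n)` embed compatibly into `κ(W)` (domination), as an increasing chain of `κ(B 0)`-subspaces `U n`; by the Krull–Akizuki
residue bound (§1 b) every `U n` has dimension `≤ ℓ(S/dS)` over `κ(B 0)` (`S = B 0 ⧸ ker φ₀`, `d` any element of `𝔪(B 0)` not killed by `φ₀`), so the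
chain is eventually stationary. [cite: Matsumura1987, Thm. 11.7] [cite: Abhyankar1956Valuations, Thm. 1] -/
theorem eventually_residue_surjective_of_shadow [IsNoetherianRing (B 0)]
    (h0 : ∃ x ∈ maximalIdeal (B 0), φ 0 x ≠ 0)
    (hfrac : ∀ n (x : B n), ∃ a b : B 0, φ 0 b ≠ 0 ∧ φ n x * φ 0 b = φ 0 a)
    (hdim : Ring.KrullDimLE 1 (B 0 ⧸ RingHom.ker (φ 0))) :
    ∃ n₀, ∀ n, n₀ ≤ n → ∀ y : B (n + 1), ∃ x : B n, y - Subring.inclusion (hdom n).1 x ∈ maximalIdeal (B (n + 1)) := by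
  classical
  -- the one-dimensional domain `S = B 0 ⧸ ker φ₀ ↪ F` and the element `d`
  let S := B 0 ⧸ RingHom.ker (φ 0)
  let jS : S →+* F := RingHom.kerLift (φ 0)
  have hjS : Function.Injective jS := RingHom.kerLift_injective (φ 0)
  haveI : (RingHom.ker (φ 0)).IsPrime := RingHom.ker_isPrime (φ 0)
  haveI : IsDomain S := Ideal.Quotient.isDomain _
  haveI : IsNoetherianRing S := inferInstance
  haveI := hdim
  have hSW : ∀ z : S, jS z ∈ W := by
    intro z
    obtain ⟨b, rfl⟩ := Ideal.Quotient.mk_surjective z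
    rw [RingHom.kerLift_mk]; exact hW 0 b
  obtain ⟨x₀, hx₀, hx₀0⟩ := h0
  have hd : Ideal.Quotient.mk (RingHom.ker (φ 0)) x₀ ≠ 0 := by
    rw [Ne, Ideal.Quotient.eq_zero_iff_mem, RingHom.mem_ker]; exact hx₀0
  have hdW : W.valuation (jS (Ideal.Quotient.mk (RingHom.ker (φ 0)) x₀)) < 1 := by
    rw [RingHom.kerLift_mk]; exact hWdom 0 x₀ hx₀
  obtain ⟨ℓ, hℓ⟩ := ENat.ne_top_iff_exists.mp (length_quotient_span_singleton_ne_top (S := S) hd)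
  -- the residue readings `ρ n : B n → κ(W)` and `κ(W)` as an algebra over `k₀ = κ(B 0)`
  let ρ : ∀ n, B n →+* ResidueField W := fun n => (residue W).comp ((φ n).codRestrict W.toSubring (hW n))
  have hρ : ∀ n (x : B n), ρ n x = residue W ⟨φ n x, hW n x⟩ := fun n x => rfl
  have hρ0 : ∀ n (x : B n), ρ n x = 0 ↔ x ∈ maximalIdeal (B n) := by
    intro n x
    rw [hρ, residue_eq_zero_iff, ValuationSubring.valuation_lt_one_iff, mem_maximalIdeal_iff_valuation_lt_one φ W hW hWdom]
  have hρincl : ∀ {m n : ℕ} (h : m ≤ n) (x : B m), ρ n (Subring.inclusion (le_of_le hdom h) x) = ρ m x := by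
    intro m n h x
    rw [hρ, hρ]; congr 1; apply Subtype.ext
    exact reading_inclusion hdom φ hφ h x
  let k₀ := ResidueField (B 0)
  have hker : ∀ a ∈ maximalIdeal (B 0), ρ 0 a = 0 := fun a ha => (hρ0 0 a).mpr ha
  let ρbar : k₀ →+* ResidueField W := Ideal.Quotient.lift (maximalIdeal (B 0)) (ρ 0) hker
  have hρbar : ∀ b : B 0, ρbar (residue (B 0) b) = ρ 0 b := fun b => Ideal.Quotient.lift_mk _ _ _
  letI : Algebra k₀ (ResidueField W) := ρbar.toAlgebra
  have hsmul : ∀ (b : B 0) (z : ResidueField W), residue (B 0) b • z = ρ 0 b * z := fun b z => by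
    rw [Algebra.smul_def]; exact congrArg (· * z) (hρbar b)
  -- the subspaces `U n = ρ n (B n)`
  let U : ℕ → Submodule k₀ (ResidueField W) := fun n =>
    { carrier := Set.range (ρ n)
      add_mem' := by rintro _ _ ⟨x, rfl⟩ ⟨y, rfl⟩; exact ⟨x + y, map_add _ _ _⟩
      zero_mem' := ⟨0, map_zero _⟩
      smul_mem' := by
        rintro c _ ⟨y, rfl⟩
        obtain ⟨b, rfl⟩ := Ideal.Quotient.mk_surjective c
        refine ⟨Subring.inclusion (le_of_le hdom (Nat.zero_le n)) b * y, ?_⟩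
        rw [map_mul, hρincl (Nat.zero_le n)]
        exact (hsmul b _).symm }
  have hU : ∀ n z, z ∈ U n ↔ ∃ y, ρ n y = z := fun n z => Iff.rfl
  have hUmono : ∀ n, U n ≤ U (n + 1) := by
    rintro n _ ⟨y, rfl⟩
    exact ⟨Subring.inclusion (hdom n).1 y, hρincl (Nat.le_succ n) y⟩
  -- the Krull–Akizuki residue bound: `rank (U n) ≤ ℓ`
  have hrank : ∀ n, Module.rank k₀ (U n) ≤ ℓ := by
    intro n
    refine rank_le fun s hs => ?_
    -- index the finset by `Fin s.card` and choose preimages in `B n`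
    let ι := s.equivFin
    have hmem : ∀ i : Fin s.card, ∃ y : B n, ρ n y = ((ι.symm i : U n) : ResidueField W) := fun i => (ι.symm i).1.2
    choose y hy using hmem
    have hcard := card_le_length_of_residue_independent jS hjS W hSW hd hdW (fun i => φ n (y i)) (fun i => hW n _)
      (fun i => ?_) ?_
    · rw [← hℓ] at hcard
      exact_mod_cast hcard
    · obtain ⟨a', b', hb', hab'⟩ := hfrac n (y i)
      exact ⟨Ideal.Quotient.mk _ a', Ideal.Quotient.mk _ b', by rwa [RingHom.kerLift_mk], by rwa [RingHom.kerLift_mk, RingHom.kerLift_mk]⟩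
    · intro c hc i
      -- lift the coefficients to `B 0`
      have hc' : ∀ i, ∃ b : B 0, Ideal.Quotient.mk (RingHom.ker (φ 0)) b = c i := fun i => Ideal.Quotient.mk_surjective (c i)
      choose b hb using hc'
      have hjb : ∀ i, jS (c i) = φ 0 (b i) := fun i => by rw [← hb i, RingHom.kerLift_mk]
      simp only [hjb] at hc ⊢
      -- the relation lives in `B n`
      let z : B n := ∑ i, Subring.inclusion (le_of_le hdom (Nat.zero_le n)) (b i) * y i
      have hz : φ n z = ∑ i, φ 0 (b i) * φ n (y i) := by
        simp only [z, map_sum, map_mul, reading_inclusion hdom φ hφ (Nat.zero_le n)]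
      rw [← hz, ← mem_maximalIdeal_iff_valuation_lt_one φ W hW hWdom, ← hρ0] at hc
      have hzρ : ρ n z = ∑ i, residue (B 0) (b i) • ((ι.symm i : U n) : ResidueField W) := by
        simp only [z, map_sum, map_mul, hρincl (Nat.zero_le n), hsmul, hy]
      rw [hzρ] at hc
      -- linear independence in `U n`
      have hrel : ∑ i, residue (B 0) (b i) • (ι.symm i : U n) = 0 := by
        apply Subtype.ext
        rw [Submodule.coe_sum]
        simp only [Submodule.coe_smul]
        exact hc
      have hli : LinearIndependent k₀ fun i : Fin s.card => (ι.symm i : U n) :=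
        hs.comp ι.symm ι.symm.injective
      have hci := (Fintype.linearIndependent_iff.mp hli) (fun i => residue (B 0) (b i)) hrel i
      rw [residue_eq_zero_iff] at hci
      exact hWdom 0 _ hci
  -- hence finite-dimensional of dimension `≤ ℓ`, monotone in `n`: eventually stationary
  haveI hfin : ∀ n, Module.Finite k₀ (U n) := fun n =>
    Module.rank_lt_aleph0_iff.mp (lt_of_le_of_lt (hrank n) (Cardinal.natCast_lt_aleph0))
  have hfr : ∀ n, Module.finrank k₀ (U n) ≤ ℓ := fun n => Module.finrank_le_of_rank_le (hrank n)
  have hfrmono : Monotone fun n => Module.finrank k₀ (U n) :=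
    monotone_nat_of_le_succ fun n => Submodule.finrank_mono (hUmono n)
  obtain ⟨n₀, hn₀⟩ := eventually_const_of_monotone_le hfrmono hfr
  refine ⟨n₀, fun n hn y => ?_⟩
  have hUeq : U n = U (n + 1) := Submodule.eq_of_le_of_finrank_eq (hUmono n) (hn₀ n hn)
  have hy : ρ (n + 1) y ∈ U n := by rw [hUeq]; exact ⟨y, rfl⟩
  obtain ⟨x, hx⟩ := hy
  refine ⟨x, (hρ0 (n + 1) _).mp ?_⟩
  rw [map_sub, hρincl (Nat.le_succ n), hx, sub_self]

end Shadow

end Summit.ResolutionOfSingularities.ResolutionOfSingularities.Cruxes.SigmaMaxModifications.IdeasL1C5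

end
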